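import Summits.BirchSwinnertonDyer.Rank1Residual.Partition.MainConjecturesIrreducibleBDP
import Summits.BirchSwinnertonDyer.BirchSwinnertonDyer.Theorems.Rank1ResidualX9TwistCriterion
import Summits.BirchSwinnertonDyer.BirchSwinnertonDyer.Theorems.ToricSheddingUBPotentiallyGoodStubTwistAdmissible
import Literature.NumberTheory.EllipticCurves.MatarNekovar2019.ShaIndexBoundIrreducible
import Literature.NumberTheory.EllipticCurves.IrreducibleModPQuadraticTwistProofs
import Literature.NumberTheory.EllipticCurves.HeegnerPointsKolyvaginExceptionalTwistProofs
import HarnessLib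

/-!
# Class X9 (irreducible NON-surjective image at a good ordinary `p ≥ 5`), analytic rank ONE: the
# HEEGNER ROAD — Burungale–Castella–Skinner's printed route to Cor. 1.3.1 (`r = 1`) re-run WITHOUT
# (sur): STEP U from Kolyvagin's bound under IRREDUCIBILITY (Matar–Nekovář 2019), the twist's rank-`0`
# engine from the K6 typed input `IntegralMainConjectureOnClassX9`, NO Schneider certificate
# (cell `bsd-print-x9`, prover seat p4 «Heegner/Kolyvagin road under irreducibility», gen 0)

HONEST FRAMING (cell `run/shared/lean/pub/bsd-print-x9/`, D-0131 print tier; verbatim from the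
charter): a leaf counts only when its class theorem is in the kernel BY NAME, flag-free; Literature
named facts are statement-only with cite tags; every imported theorem carries its printed hypotheses
verbatim; a stall becomes a NAMED residual crux. THEOREMS ONLY in this file (no definition, no named
fact, no `sorry`); every published theorem enters as one of the tree's existing named Literature facts
BY NAME; every unproved statement enters as an EXPLICIT binder. Nothing about any particular curve is
asserted; no label changes; `BSDpOnClassX9` (rung K6) is NOT claimed closed here.

## What this file does (the X9 twin of `Partition/MainConjecturesIrreducible{,Class}.lean` + `AnticyclotomicControlJSW.lean`)

The tree holds a kernel proof of the PRINTED route of BCS 2025 Cor. 1.3.1 (`r = 1`) — "Theorem 1.2.4,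
the `p`-adic Waldspurger formula [BDP13], the anticyclotomic control theorem [JSW17, Thm. 3.3.1], and
the `r = 0` result for the `K`-quadratic twist of `E`" (arXiv:2405.00270v2 p. 4) — as
`bsdp_rankOne_of_thm331_of_columnMainConjecture_odd` / `RowC2.bsdp_of_bcsThm112b_of_thm331_of_thm124b`.
On that road the SURJECTIVITY of `ρ̄_{E,p}` enters in exactly three places: (U) Kolyvagin's bound
`ord_p #Ш(E/K) ≤ 2·ord_p[E(K):ℤy_K]` as printed by McCallum 1991 (`Kolyvagin1990_padicValNat_card_sha_le`,
"`Gal(ℚ(E_p)/ℚ) = GL₂(ℤ/pℤ)`"); (T) the transport of the hypotheses to a minimal model of the twist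
`E^{(d_K)}` (`X11b.surj_twist_model` → (im) for BCS Thm. 1.1.2 (b) at the twist); (A) the anticyclotomic
main conjecture INTEGRALLY (BCS Thm. 1.2.4 (b), the `thm124b_thm513` composite). Class X9
(`Rank1Residual.ClassX9 W p`: non-CM, `p ≥ 5` good ordinary, `E[p]` irreducible, `ρ̄_{E,p}` NOT
surjective) fails (sur) by definition. This file re-runs the road with:

* (U) ← **Matar–Nekovář 2019 Thm. 0.3 + §0.11** = Kolyvagin's bound under IRREDUCIBILITY ONLY
  (`MatarNekovar2019.thm03_padicValNat_card_sha_le_of_irreducible`, PUBLISHED; flags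
  `MN19-0.11-composite`, `Kolyvagin1990-Cor13-primary-unread` travel with it): §2
  `indexIdentityAt_of_lowerBound_of_matarNekovar`.
* (T) ← the twist-closure of class X9 (§1 `classX9_twist_model`: `j`-invariance of CM, Mazur 1978 /
  Silverman X.5.4 for (irr) and for NON-surjectivity — the latter by the tree's signed-isomorphism
  lemma `twistAdmissible_hasSurjectiveModNGaloisRep_of_addEquiv_signed` applied to the INVERSE
  isomorphism —, good ordinary reduction at `p ∤ d_K` by `X11b.goodOrd_twist_model`), so that the
  twist's rank-`0` input is the K6 typed rank-`0` engine `IntegralMainConjectureOnClassX9` (the cell's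
  sister route `SmallImageMuTransfer`: `MuTransfer` ∧ `AnalyticMuZeroX9`; or any other road to it) read
  as `MazurMainConjecture` in the Néron normalisation (§1 `mazurMainConjecture_of_integralMainConjectureOnClassX9`,
  the block of `bsdpOnClassX9_of_integralMainConjectureOnClassX9`).
* (A) ← kept as the typed input `hLA` = (IMC≥∘BDP)ᵍ (`X11b.IMCLowerWaldspurgerOnTreeGoodAt`, the
  ONE-SIDED link, which is all the road consumes); it is discharged from Burungale–Castella–Skinner 2025
  Thm. 1.2.4 (a) + Prop. 4.2.2 (`μ(L_p^BDP) = 0`, Hsieh) + CGLS 2022 Thm. 5.1.3 — printed under (irr_ℚ)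
  WITHOUT (sur) — in the companion `PrintX9HeegnerIMCLink.lean`.
* (irred_𝒦) at the Heegner field ← kept as the binder `hIrrK` (JSW's own hypothesis); discharged
  from Matar–Nekovář 2019 Prop. 5.26 (2) in the companion `PrintX9HeegnerClass.lean`.

Theorems: §3 `X9.bsdp_rankOne_of_indexLowerBoundAt_of_twist_mazurMainConjecture` (datum level: STEP L
+ MN19 + Gross–Zagier + the twist's typed cyclotomic main conjecture ⇒ `BSD(E,p)`); the pair level
(Hoffstein–Luo field, Manin-unit datum, Néron model of the twist and its X9 transports) and the form
with the control link PUBLISHED (JSW Thm. 3.3.1) are in the companion `PrintX9HeegnerRankOnePair.lean`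
(size split), the class-level assembly in `PrintX9HeegnerClass.lean`. Locus: `ClassX9 W p`, `ord_{s=1} L(E,s) = 1`, `p ∤ ∏_ℓ c_ℓ(E)` (where STEP L and STEP U
meet; the Tamagawa-divisible rank-one pairs are a NAMED residual of the road, as for row C2).
NO Schneider / `p`-adic height hypothesis anywhere: on this road the rank-one X9 pairs need, beyond
print, only the rank-ZERO input at the twist.

References: Burungale–Castella–Skinner, IMRN 2025 rnaf082 = arXiv:2405.00270v2, Thm. 1.2.4, Prop.
4.2.2, Cor. 1.3.1 and its proof (p. 4) [BurungaleCastellaSkinner2025]; Matar–Nekovář, JTNB 31 (2019),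
Thm. 0.3, §0.11, Prop. 5.26 [MatarNekovar2019]; Jetchev–Skinner–Wan, Camb. J. Math. 5 (2017) Thm.
3.3.1, §7.4.1 [JetchevSkinnerWan2017]; Gross–Zagier 1986 [GrossZagier1986]; Kolyvagin 1990 Thm. A
[KolyvaginEulerSystems1990]; Greenberg LNM 1716 Thm. 4.1 [GreenbergLNM1716]; Hoffstein–Luo 1997
[HoffsteinLuo1997]; Mazur 1978 Cor. 4.1 [Mazur1978]; Silverman AEC X.5 Cor. 5.4 [SilvermanAEC2009];
Miller 2011 Def. 1.1 [Miller2011LMS]; the sister route file `Theses/SmallImageMuTransfer.lean`.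
-/

set_option linter.dupNamespace false
set_option autoImplicit false

noncomputable section

open scoped Classical MatrixGroups ModularForm

open CongruenceSubgroup WeierstrassCurve NumberField IsDedekindDomain
  Literature.NumberTheory.EllipticCurves Literature.NumberTheory.EllipticCurves.ModularForms
  Literature.NumberTheory.EllipticCurves.BurungaleCastellaSkinner2025
  Literature.NumberTheory.EllipticCurves.JetchevSkinnerWan2017
  Summit.BirchSwinnertonDyer.BirchSwinnertonDyer.Theorems.Rank1ResidualX1Defs
  Summit.BirchSwinnertonDyer.Rank1Residual

open Literature.NumberTheory.EllipticCurves.KrizLi2019 (lDerivEK_eq_deriv_mul)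
open Summit.BirchSwinnertonDyer.BirchSwinnertonDyer.Theorems
  (twistAdmissible_hasSurjectiveModNGaloisRep_of_addEquiv_signed)
open Literature.NumberTheory.EllipticCurves.Rank1Residual (GoodOrd Irr Surj BigIm
  norm_periodRatio_eq_one pPart_of_bsdp not_dvd_discr_of_split
  exists_admissibleField_of_rootNumber_eq_neg_one)

namespace Summit.BirchSwinnertonDyer.BirchSwinnertonDyer.Rank1Residual

/-! ### §1 Class X9 is twist-closed along a Heegner twist, and its rank-`0` engine in Mazur's shape -/

section Transports

variable {W : WeierstrassCurve ℚ} [W.IsElliptic] [W.IsGloballyMinimal] {p : ℕ} [Fact p.Prime]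

/-- A signed (`Γ_ℚ`-equivariant up to `±1` at each `σ`) additive isomorphism of geometric points
has a signed inverse. [folklore] -/
theorem signed_symm {W₁ W₂ : WeierstrassCurve ℚ} (f : geomPoints W₁ ≃+ geomPoints W₂)
    (hf : ∀ σ : Field.absoluteGaloisGroup ℚ,
      (∀ P, f (σ • P) = σ • f P) ∨ (∀ P, f (σ • P) = -(σ • f P))) :
    ∀ σ : Field.absoluteGaloisGroup ℚ,
      (∀ Q, f.symm (σ • Q) = σ • f.symm Q) ∨ (∀ Q, f.symm (σ • Q) = -(σ • f.symm Q)) := by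
  intro σ
  rcases hf σ with hs | hs
  · left
    intro Q
    apply f.injective
    rw [f.apply_symm_apply, hs, f.apply_symm_apply]
  · right
    intro Q
    apply f.injective
    rw [f.apply_symm_apply, map_neg, hs, f.apply_symm_apply, neg_neg]

/-- **`ρ̄_{E,p}` onto ⟸ `ρ̄_{E^{(d)},p}` onto**, for any model `C • W^{(d)}` of the quadratic twist by
`d ≠ 0` (the converse of the tree's `twistAdmissible_hasSurjectiveModNGaloisRep_smul_quadraticTwist`:
the same signed isomorphism `(C • W^{(d)})(ℚ̄) ≃+ W(ℚ̄)`, inverted). Silverman X.2 Prop. 2.4 / X.5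
Cor. 5.4: `ρ̄_{E^d,p} ≅ ρ̄_{E,p} ⊗ χ_d`, and `−1` is a square in `Aut(E[p])`.
[cite: SilvermanAEC2009, X.5 Cor. 5.4 and X.2 Prop. 2.4] -/
theorem hasSurjectiveModNGaloisRep_of_smul_quadraticTwist (W : WeierstrassCurve ℚ) [W.IsElliptic]
    {d : ℚ} (hd : d ≠ 0) (C : VariableChange ℚ) (p : ℕ) [Fact p.Prime]
    (h : (C • W.quadraticTwist d).HasSurjectiveModNGaloisRep p) :
    W.HasSurjectiveModNGaloisRep p := by
  haveI : (W.quadraticTwist d).IsElliptic := W.isElliptic_quadraticTwist hd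
  obtain ⟨f, hf⟩ := W.exists_addEquiv_geomPoints_quadraticTwist_signed hd
  -- `g : (C • W^d)(ℚ̄) ≃+ W(ℚ̄)`, signed; its inverse is signed too
  let e₁ : geomPoints (C • W.quadraticTwist d) ≃+ geomPoints (W.quadraticTwist d) :=
    (geomPointsEquiv (W.quadraticTwist d) C).symm
  have he₁ : ∀ (σ : Field.absoluteGaloisGroup ℚ) (P : geomPoints (C • W.quadraticTwist d)),
      e₁ (σ • P) = σ • e₁ P := fun σ P ↦ by
    apply (geomPointsEquiv (W.quadraticTwist d) C).injective
    change geomPointsEquiv (W.quadraticTwist d) C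
        ((geomPointsEquiv (W.quadraticTwist d) C).symm (σ • P)) =
      geomPointsEquiv (W.quadraticTwist d) C (σ • (geomPointsEquiv (W.quadraticTwist d) C).symm P)
    rw [AddEquiv.apply_symm_apply, geomPointsEquiv_smul, AddEquiv.apply_symm_apply]
  have hg : ∀ σ : Field.absoluteGaloisGroup ℚ,
      (∀ P, (e₁.trans f) (σ • P) = σ • (e₁.trans f) P) ∨
        (∀ P, (e₁.trans f) (σ • P) = -(σ • (e₁.trans f) P)) := by
    intro σ
    rcases hf σ with hs | hs
    · left
      intro P
      rw [AddEquiv.trans_apply, AddEquiv.trans_apply, he₁, hs]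
    · right
      intro P
      rw [AddEquiv.trans_apply, AddEquiv.trans_apply, he₁, hs]
  exact twistAdmissible_hasSurjectiveModNGaloisRep_of_addEquiv_signed (e₁.trans f).symm
    (signed_symm (e₁.trans f) hg) p h

/-- **Class X9 is twist-closed along a Heegner twist**: for `W` of class X9 at `p` (non-CM, `p ≥ 5`
good ordinary, `E[p]` irreducible, `ρ̄_{E,p}` not surjective), a quadratic field `K` with `p ∤ d_K`,
and a globally minimal model `Wd = Cd • W^{(d_K)}` of the twist: `Wd` is of class X9 at `p`. CM is a
property of `j` (`j(E^d) = j(E)`); good ordinary reduction transports as in row C2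
(`X11b.goodOrd_twist_model`, `p ∤ 2d_K`); (irr) by `ρ̄_{E^d,p} ≅ ρ̄_{E,p} ⊗ χ_d` (Mazur 1978 /
tree `hasIrreducibleModPGaloisRep_iff_of_smul_eq_quadraticTwist`); NON-surjectivity by the converse
transport `hasSurjectiveModNGaloisRep_of_smul_quadraticTwist`.
[cite: SilvermanAEC2009, X.5 Cor. 5.4] [cite: Mazur1978, §5 (twist invariance of the mod-p image type)] -/
theorem classX9_twist_model (hX9 : ClassX9 W p) (K : Type) [Field K] [NumberField K]
    (h2 : Module.finrank ℚ K = 2) (hpd : ¬ (p : ℤ) ∣ NumberField.discr K)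
    {Wd : WeierstrassCurve ℚ} [Wd.IsElliptic] [Wd.IsGloballyMinimal] (Cd : VariableChange ℚ)
    (hWd : Cd • W.quadraticTwist (NumberField.discr K : ℚ) = Wd) : ClassX9 Wd p := by
  obtain ⟨hcm, hp5, hgood, hord, hirr, hns⟩ := hX9
  have hp2 : p ≠ 2 := by omega
  have hD0 : (NumberField.discr K : ℚ) ≠ 0 := by exact_mod_cast NumberField.discr_ne_zero K
  haveI hEt : (W.quadraticTwist (NumberField.discr K : ℚ)).IsElliptic :=
    W.isElliptic_quadraticTwist hD0
  have hordd : GoodOrd Wd p := X11b.goodOrd_twist_model W p K h2 hp2 hpd ⟨hgood, hord⟩ Cd hWd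
  refine ⟨?_, hp5, hordd.1, hordd.2, ?_, ?_⟩
  · -- no CM: `j(Wd) = j(W)`
    have hj : Wd.j = W.j := by
      have h1 : Wd.j = (Cd • W.quadraticTwist (NumberField.discr K : ℚ)).j := by subst hWd; rfl
      rw [h1, variableChange_j]
      exact W.j_quadraticTwist hD0
    rwa [hasCM_iff_of_j_eq hj]
  · have hC : Cd⁻¹ • Wd = W.quadraticTwist (NumberField.discr K : ℚ) := by
      rw [← hWd, inv_smul_smul]
    exact (hasIrreducibleModPGaloisRep_iff_of_smul_eq_quadraticTwist W Wd hD0 hC p).mpr hirr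
  · intro hsd
    apply hns
    rw [← hWd] at hsd
    exact hasSurjectiveModNGaloisRep_of_smul_quadraticTwist W hD0 Cd p hsd

/-- **The K6 typed rank-`0` engine in Mazur's shape.** `IntegralMainConjectureOnClassX9` (the sister
route's typed input: `ch_Λ X(E/ℚ_∞) = (g)`, `ι g = L_p(f, α)` on the nose, at every X9 pair) rescaled
by the period unit `ϖ` (`Ω_E = ϖ·Ω⁺_f`, `‖ϖ‖_p = 1` under (irr): `norm_periodRatio_eq_one`, binder `h5`)
IS the cell's `MazurMainConjecture W p` (Néron normalisation) at every X9 pair — the block of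
`bsdpOnClassX9_of_integralMainConjectureOnClassX9`, isolated. [cite: GreenbergVatsal2000, Rem. 3.4 (the period unit)]
[cite: CastellaGrossiSkinner2025, Introduction (MC) (the shape `MazurMainConjecture`)] -/
theorem mazurMainConjecture_of_integralMainConjectureOnClassX9
    (h5 : realPeriodRat_eq_unit_mul_plusPeriod) (hIMC : IntegralMainConjectureOnClassX9)
    (hX9 : ClassX9 W p) : MazurMainConjecture W p := by
  obtain ⟨-, hp, hgood, -, hirr, -⟩ := id hX9
  intro κ γ hκ hγ hγ' _ f hf ϖ hϖeq D
  obtain ⟨htors, g, hchar, hιg⟩ := hIMC W p κ γ f hX9 hκ hγ hγ' hf D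
  have hϖnorm : ‖(ϖ : ℚ_[p])‖ = 1 := norm_periodRatio_eq_one h5 W p hp hgood hirr f hf ϖ hϖeq
  set c : ℤ_[p] := ⟨(ϖ : ℚ_[p]), hϖnorm.le⟩ with hc_def
  have hcu : IsUnit c := PadicInt.isUnit_iff.mpr hϖnorm
  refine ⟨htors, PowerSeries.C c * g, ?_, ?_⟩
  · rw [hchar]
    exact (Ideal.span_singleton_mul_left_unit (hcu.map PowerSeries.C) g).symm
  · rw [map_mul, hιg, PowerSeries.map_C]
    rfl

end Transports

/-! ### §2 STEP L + Kolyvagin's bound UNDER IRREDUCIBILITY (Matar–Nekovář 2019) ⇒ the index identity over `K` -/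

/-- **Lower bound (typed input) + Kolyvagin's upper bound under IRREDUCIBILITY ⇒ the Heegner-index
identity over `K`, at a pair with `p ∤ ∏_ℓ c_ℓ(E/ℚ)`** — the X9 twin of
`X11b.indexIdentityAt_of_lowerBound_of_kolyvagin` (which needs `ρ̄_{E,p}` onto): here the upper bound
`ord_p #Ш(E/K) ≤ 2·ord_p [E(K):ℤP]` is Matar–Nekovář 2019 Thm. 0.3 + §0.11 (= Kolyvagin 1990 Cor. 13
with its condition (a) discharged by Cor. 5.21 (e′) / Prop. 5.26 (2)), PUBLISHED, tree fact
`MatarNekovar2019.thm03_padicValNat_card_sha_le_of_irreducible` (`hMN`): `E[p]` irreducible, `p ≠ 2`,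
`K` imaginary quadratic with the Heegner hypothesis for the level and `d_K ≠ −3, −4`, `P = y_K`
non-torsion — NO surjectivity, no non-CM, no reduction hypothesis at `p`. Squeezed against STEP L
`2·ord_p [E(K):ℤP] ≤ ord_p #Ш(E/K) + 2·ord_p ∏_ℓ c_ℓ(E)` when `ord_p ∏_ℓ c_ℓ(E) = 0`.
[cite: MatarNekovar2019, Thm. 0.3 (p. 456) and §0.11 (p. 457)] [cite: JetchevSkinnerWan2017, §7.4.1–7.4.3 (pp. 30–31)] -/
theorem indexIdentityAt_of_lowerBound_of_matarNekovar
    (W : WeierstrassCurve ℚ) [W.IsElliptic] (p : ℕ) [Fact p.Prime] {N : ℕ} [NeZero N]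
    {K : Type} [Field K] [NumberField K]
    (hMN : MatarNekovar2019.thm03_padicValNat_card_sha_le_of_irreducible N W K)
    (hK : IsImaginaryQuadratic K) (hH : SatisfiesHeegnerHypothesis N K)
    (hD3 : NumberField.discr K ≠ -3) (hD4 : NumberField.discr K ≠ -4)
    {P : (W.baseChange K).toAffine.Point} (hP : IsHeegnerPoint N W K P) (hnt : ¬ IsOfFinAddOrder P)
    (hp2 : p ≠ 2) (hirr : W.HasIrreducibleModPGaloisRep p) (htam : ¬ p ∣ W.tamagawaProduct)
    (hL : X11b.IndexLowerBoundAt W p K P) : X11b.IndexIdentityAt W p K P := by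
  have hp : p.Prime := Fact.out
  have hle := hMN hK hH hD3 hD4 hP hnt hp hp2 hirr
  have h0 : padicValNat p W.tamagawaProduct = 0 := padicValNat.eq_zero_of_not_dvd htam
  unfold X11b.IndexLowerBoundAt at hL
  unfold X11b.IndexIdentityAt
  rw [WeierstrassCurve.shaOrder] at hL ⊢
  omega

/-! ### §3 Rank one at a Heegner datum, class X9: STEP L + Matar–Nekovář + Gross–Zagier + the twist's typed cyclotomic main conjecture -/

/-- **Rank one at a good ordinary `p ≥ 5` with `E[p]` IRREDUCIBLE (surjective or not), at a Heegner
datum: STEP L + Kolyvagin-under-irreducibility + Gross–Zagier + the CYCLOTOMIC MAIN CONJECTURE OF THE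
TWIST (as the tree types it: `MazurMainConjecture Wd p`) + Greenberg's control theorem ⇒ `BSD(E,p)`**
— the X9 twin of `X11b.bsdp_rankOne_of_indexLowerBoundAt_of_twist_mazurMainConjecture` (row C2, which
asks `ρ̄_{E,p}` onto for Kolyvagin's bound). The one change: STEP U is Matar–Nekovář 2019 (`hMN`,
irreducibility only; `d_K ≠ −3, −4` from `d_K < −4`). Data: `K` imaginary quadratic with the Heegner
hypothesis for the level `N` and `L(E^{d_K},1) ≠ 0`, `d_K < −4`, `P` the Heegner point of a
parametrisation datum `Dt` with `p ∤ c(Dt)`, `p ∤ #𝓞_K^×`, a globally minimal model `Wd = Cd •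
E^{(d_K)}` good ordinary at `p` with the two decidable side conditions (`htam`, `hu`). The pair:
`ord_{s=1} L(E,s) = 1`, `p ≠ 2`, `E[p]` irreducible, `p ∤ ∏_ℓ c_ℓ(E)`. PUBLISHED inputs by name:
Gross–Zagier (`hGZ`), Kolyvagin 1990 Thm. A (`hKo`), Matar–Nekovář 2019 (`hMN`), Greenberg Thm. 4.1
(`hGr`), GZK (`hGZK`), modularity (`hmod`, `hpar`). TYPED inputs: STEP L `IndexLowerBoundAt W p K P`
(`hL`) and `MazurMainConjecture Wd p` (`hMCd`). Chain: STEP L + STEP U ⇒ identity over `K` ⇒ the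
descent `X11b.bsdp_of_indexIdentityAt`, "the `r = 0` result for the `K`-quadratic twist of `E`" (BCS
Cor. 1.3.1, proof) being DERIVED from `hMCd` by `padicValRat_bsd_rank_zero_of_mazurMainConjecture`.
[cite: BurungaleCastellaSkinner2025, Cor. 1.3.1 (r = 1), proof (p. 4)]
[cite: MatarNekovar2019, Thm. 0.3 (p. 456) and §0.11 (p. 457)]
[cite: JetchevSkinnerWan2017, §7.4.1 (pp. 30–31)] [cite: GreenbergLNM1716, Thm. 4.1 (p. 102)]
[cite: GrossZagier1986, I (6.5) and V (2.1)] [cite: Miller2011LMS, Def. 1.1] -/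
theorem X9.bsdp_rankOne_of_indexLowerBoundAt_of_twist_mazurMainConjecture
    (W : WeierstrassCurve ℚ) [W.IsElliptic] [W.IsGloballyMinimal] (p : ℕ) [Fact p.Prime]
    (N : ℕ) [NeZero N] (K : Type) [Field K] [NumberField K]
    (Dt : ModularParametrizationData W N) (H : HeegnerDatum N (NumberField.discr K)) (ι : K →+* ℂ)
    (P : (W.baseChange K).toAffine.Point)
    -- the published inputs (named facts of the tree)
    (hGZ : gross_zagier N W K) (hKo : kolyvagin N W K)
    (hMN : MatarNekovar2019.thm03_padicValNat_card_sha_le_of_irreducible N W K)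
    (hGr : greenberg_charValue_rankZero)
    (hGZK : rank_eq_analyticRank_of_analyticRank_le_one) (hmod : hasEntireLFunction_rat)
    (hpar : nonempty_modularParametrizationData)
    -- the pair
    (hr : W.analyticRank = 1) (hp2 : p ≠ 2) (hirr : W.HasIrreducibleModPGaloisRep p)
    (htam0 : ¬ p ∣ W.tamagawaProduct)
    -- the Heegner data
    (hK : IsImaginaryQuadratic K) (hlt : NumberField.discr K < -4)
    (hHN : SatisfiesHeegnerHypothesis N K)
    (hP : WeierstrassCurve.Affine.Point.map ι.toRatAlgHom P = heegnerPointComplex Dt H)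
    (hc : ¬ (p : ℤ) ∣ Dt.c) (hμ : ¬ p ∣ Units.torsionOrder K)
    (hLt : (W.quadraticTwist (NumberField.discr K : ℚ)).entireLFunction 1 ≠ 0)
    -- a globally minimal model of the twist, good ordinary at `p`, the side conditions
    (Wd : WeierstrassCurve ℚ) [Wd.IsElliptic] [Wd.IsGloballyMinimal] (Cd : VariableChange ℚ)
    (hWd : Cd • W.quadraticTwist (NumberField.discr K : ℚ) = Wd) (hordd : GoodOrd Wd p)
    (htam : padicValNat p Wd.tamagawaProduct = padicValNat p W.tamagawaProduct)
    (hu : padicValRat p (Cd.u : ℚ) = 0)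
    -- the typed inputs: the twist's cyclotomic main conjecture and STEP L at the datum
    (hMCd : MazurMainConjecture Wd p) (hL : X11b.IndexLowerBoundAt W p K P) : BSDp W p := by
  have hD0 : (NumberField.discr K : ℚ) ≠ 0 := by exact_mod_cast NumberField.discr_ne_zero K
  haveI hEt : (W.quadraticTwist (NumberField.discr K : ℚ)).IsElliptic :=
    W.isElliptic_quadraticTwist hD0
  -- the Heegner point has infinite order (Gross–Zagier, `L'(E,1) ≠ 0`, `L(E^D,1) ≠ 0`)
  have hL0 : W.entireLFunction 1 = 0 := entireLFunction_one_eq_zero_of_analyticRank_eq_one hr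
  obtain ⟨-, hderiv⟩ := leadingLCoeff_eq_deriv_of_analyticRank_eq_one hr
  have hLK : LDerivEK W K ≠ 0 := by
    rw [lDerivEK_eq_deriv_mul W K hmod hL0]; exact mul_ne_zero hderiv hLt
  have hPH : IsHeegnerPoint N W K P := ⟨Dt, H, ι, hP⟩
  have hPinf : ¬ IsOfFinAddOrder P :=
    (lDerivEK_ne_zero_iff_not_isOfFinAddOrder W N K hGZ hK hHN hPH).mp hLK
  -- STEP L + STEP U (Matar–Nekovář) ⇒ the identity over `K`
  have hid : Finite (W.baseChange K).sha → X11b.IndexIdentityAt W p K P := fun _ =>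
    indexIdentityAt_of_lowerBound_of_matarNekovar W p hMN hK hHN (by omega) (by omega) hPH hPinf hp2
      hirr htam0 hL
  -- the twist: analytic rank `0`, finiteness, and its rank-`0` `p`-part FROM ITS MAIN CONJECTURE
  have hLt' : (W.quadraticTwist (NumberField.discr K : ℚ)).entireLFunction = Wd.entireLFunction := by
    rw [← hWd, entireLFunction_smul]
  have hLd1 : Wd.entireLFunction 1 ≠ 0 := by rw [← hLt']; exact hLt
  have hfinSd : Finite Wd.sha := (hGZK Wd (by
    rw [(Wd.analyticRank_eq_zero_iff_holds (hmod Wd)).2 hLd1]; exact zero_le_one)).2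
  have htw := padicValRat_bsd_rank_zero_of_mazurMainConjecture Wd p hordd.1 hordd.2 hLd1 hfinSd hpar
    (fun κ γ hκ hγ hγ' D _ hX fE hfE hSel ↦
      hGr Wd p hp2 hordd.1 hordd.2 κ γ hκ hγ hγ' D hX fE hfE hSel) hMCd
  exact X11b.bsdp_of_indexIdentityAt W p N K Dt H ι P hGZ hKo hGZK hmod hK hHN hP hp2 hc hμ hr hLt Wd
    Cd hWd htw htam hu hid

end Summit.BirchSwinnertonDyer.BirchSwinnertonDyer.Rank1Residual

end
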